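import Summits.ABC.ABC.Theorems.DefiniteXiFreyModularityStubAbsIrrNegThree
import Summits.ABC.ABC.Theorems.DefiniteXiFreyModularityCMCorner
import Literature.NumberTheory.DiophantineGeometry.GeneralizedFermatTwoPowerCoefficientFreyProofs
import Literature.NumberTheory.Automorphic.CDTTheorem722
import HarnessLib

/-!
# `stub_liftThree` — ideator k3 (gen 2), Family 3: the two PROVED extremal certificates

Sibling of `STUB_IDEAS_stub_liftThree_3.lean` (see its header and `STUB-IDEAS-stub_liftThree-3.md`).

* E1 `liftThree_hypotheses_and_conclusion_freyCurve_one_one`, `liftThree_instance` — PROVED: at the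
  CM corner `E_(1,1) : y² = x³ − x` (`N = 32`) every framed `ρ̄` of `E[3]` satisfies ALL hypotheses of
  `stub_liftThree` and the conclusion holds — the hypothesis class is inhabited, no junk reading, and
  the four `ℓ = 3` carriers compose (composition of four landed theorems).
* E2 `freyCurve_at_three_extremes` — PROVED from landed pieces: a Frey curve is never good-ordinary
  at `3` (`3 ∤ abc` ⇒ good supersingular with `a₃ = 0`; `3 ∣ abc` ⇒ multiplicative), so site (A) of
  `liftThree_of_stubs` only meets the two extremes of the local condition `9 ∤ N`.
-/

noncomputable section

open scoped MatrixGroups NumberField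
open Literature.NumberTheory.EllipticCurves Literature.NumberTheory.EllipticCurves.ModularForms
open Literature.NumberTheory.Automorphic Literature.NumberTheory.Automorphic.BCDT
open Literature.NumberTheory.GaloisRepresentations
open WeierstrassCurve IsDedekindDomain NumberField
open Summit.ABC.ABC.Theorems

namespace Summit.ABC.ABC.Cruxes.FreyModularity.StubIdeas3

/-! ## E1. Non-vacuity certificate at the CM corner `E_(1,1) : y² = x³ − x` (PROVED) -/

/-- Every framed model `ρ̄` of `E_(1,1)[3]` satisfies ALL hypotheses of the stub and its conclusion:
abs. irreducible over `ℚ(√-3)` (`3 ∤ 1·1·2`, order-8 inertia at the supersingular prime `3`),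
`9 ∤ 32`, `ρ̄` modular and `ρ_{E,3}` modular (the corner is `BCDT.IsModular`). -/
theorem liftThree_hypotheses_and_conclusion_freyCurve_one_one
    (ρ : ModPGaloisRep ℚ (ZMod 3) 2) (hρ : (freyCurve 1 1).IsTorsionGaloisRep 3 ρ) :
    ρ.IsAbsIrreducibleOverSqrt (-3) ∧ ¬ 9 ∣ (freyCurve 1 1).conductorNorm ℤ ∧ ρ.IsModular ∧
      (freyCurve 1 1).IsModularGaloisRepTate 3 := by
  haveI : (freyCurve 1 1).IsElliptic := isElliptic_freyCurve (by norm_num)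
  haveI : Fact (Nat.Prime 3) := ⟨Nat.prime_three⟩
  haveI : NeZero ((freyCurve 1 1).conductorNorm ℤ) := ⟨(conductorNorm_pos_holds _).ne'⟩
  refine ⟨isAbsIrreducibleOverSqrt_negThree_freyCurve_of_not_three_dvd 1 1 isCoprime_one_left
      (by norm_num) (by norm_num) ρ hρ, ?_, isModular_modThree_freyCurve_one_one hρ,
    isModular_freyCurve_one_one.isModularGaloisRepTate 3⟩
  rw [conductorNorm_freyCurve_one_one]; norm_num

/-- The hypothesis class of `stub_liftThree` is inhabited, with the conclusion (no vacuity). -/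
theorem liftThree_instance :
    ∃ (W : WeierstrassCurve ℚ) (_ : W.IsElliptic) (ρ : ModPGaloisRep ℚ (ZMod 3) 2),
      W.IsTorsionGaloisRep 3 ρ ∧ ρ.IsAbsIrreducibleOverSqrt (-3) ∧ ¬ 9 ∣ W.conductorNorm ℤ ∧
        ρ.IsModular ∧ W.IsModularGaloisRepTate 3 := by
  haveI : (freyCurve 1 1).IsElliptic := isElliptic_freyCurve (by norm_num)
  haveI : Fact (Nat.Prime 3) := ⟨Nat.prime_three⟩
  haveI : NeZero ((3 : ℕ) : ℚ) := ⟨by norm_num⟩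
  obtain ⟨ρ, hρ⟩ := (freyCurve 1 1).exists_isTorsionGaloisRep 3
  exact ⟨freyCurve 1 1, inferInstance, ρ, hρ,
    liftThree_hypotheses_and_conclusion_freyCurve_one_one ρ hρ⟩

/-! ## E2. Extremal configuration at `3` on the Frey family (PROVED from landed pieces) -/

/-- A Frey curve `E_(a,b)` (`a ⊥ b`, `ab(a+b) ≠ 0`) is never good-ordinary at `3`: if `3 ∤ abc` it
has good SUPERSINGULAR reduction at the place over `3` (`a₃ = 0`); if `3 ∣ abc` it has
MULTIPLICATIVE reduction there.  So site (A) of `liftThree_of_stubs` only ever meets the two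
extremes {flat-supersingular, multiplicative} of the local condition `9 ∤ N`. -/
theorem freyCurve_at_three_extremes {a b : ℤ} (hab : IsCoprime a b) (h0 : a * b * (a + b) ≠ 0) :
    (¬ (3 : ℤ) ∣ a * b * (a + b) →
        (∀ v : HeightOneSpectrum (𝓞 ℚ), (Rat.HeightOneSpectrum.primesEquiv v : ℕ) = 3 →
          (freyCurve a b).HasGoodReductionAt v) ∧ (freyCurve a b).LFunction 3 = 0) ∧
    ((3 : ℤ) ∣ a * b * (a + b) →
        ∀ v : HeightOneSpectrum ℤ, Rat.HeightOneSpectrum.natGenerator v = 3 →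
          (freyCurve a b).HasMultiplicativeReductionAt v) := by
  refine ⟨fun h3 ↦ ⟨fun v hv ↦ hasGoodReductionAt_freyCurve_three h3 hv,
    lFunction_freyCurve_three h3⟩, fun h3 v hv ↦ ?_⟩
  refine Literature.NumberTheory.DiophantineGeometry.hasMultiplicativeReductionAt_freyCurve_of_ne_two hab h0 v (by rw [hv]; decide) ?_
  rw [hv]
  exact_mod_cast h3

end Summit.ABC.ABC.Cruxes.FreyModularity.StubIdeas3

end
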